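import Summits.Ventures.CertifiedArithmetic.LowPrec.SRPythagorasMirror
import HarnessLib

/-!
# Stochastic rounding in low-precision formats XCVII — lever windows and the Pythagorean law for
# StochasticA on windows ACROSS ZERO

HONEST FRAMING: certified error envelopes and provably optimal rounding/accumulation schemes for
low-precision formats under stated cost models; every table by two implementations; no hardware or
vendor claims.

`LeverWindow F N lo hi g` is the abstract form of XCIV's hypothesis: `lo, hi ∈ F`, window values on
`lo + gℤ`, and the one-step mean `τ` of StochasticA with `N` bits MONOTONE and `1`-LIPSCHITZ on
grid-congruent window points, `0 ≤ τ(c') − τ(c) ≤ c' − c`.  XCIV's chain needs nothing else: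
contraction of the mean map (`LeverWindow.accExpQA_contract`, the induction of XCIV verbatim),
drift-antitonicity (`.driftAntitone_stochasticA`) and, with candidate gaps `≤ G`, the law
`E(ŝₙ − sₙ)² ≤ n·G²/4 + (n·2^{-N}·G)²` for every `n` (`.stochasticA_acc_sq_le`, via XCII).
A one-signed nested window with `N ≥ J` is a lever window (XCIV `stepQA_lever`; `NestedWindow.leverWindow`),
and — the point of this file — so is a window `[−hi', hi]` ACROSS ZERO of a symmetric value set containing
`0` whose halves `[0, hi]`, `[0, hi']` are nested with spans `J, J' ≤ N` (`leverWindow_twoSided`): on the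
positive half the lever is XCIV's, on the negative half its mirror image (XCVI `stepQ_id_neg`), and for
`c < 0 < c'` it is free, because truncation moves both points TOWARDS zero:
`c ≤ τ(c) ≤ ⌈c⌉_F ≤ 0 ≤ ⌊c'⌋_F ≤ τ(c') ≤ c'`.  Hence (`stochasticA_twoSided`) drift-antitonicity and the
law for every `n` on every such window, bits ≥ binades of the LARGER side, `G` = the top spacing.
File XCVIII instantiates this for every `Format`: the whole range `[−maxRat, maxRat]` with
`N ≥ emaxCode − 1` bits — no window hypothesis at all.
Scope (honest): no saturation; nothing is claimed for fewer bits (cert `certs/sr/gen17/nested` C6 records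
`0` violations of the law with fewer bits across zero, evidence only).  Prior art: [ElararEtAl2025,
Thm. 3–4]; [ConnollyHighamMary2021, Lemma 4.4]; IEEE P3109.  No Mathlib precedent.
-/

namespace Summit.Ventures.CertifiedArithmetic.LowPrec.SR

open Literature.ComputerArithmetic.ConnollyHighamMary2021
open Finset

variable {K : Type*} [Field K] [LinearOrder K] [IsStrictOrderedRing K] [FloorRing K]

namespace LimitedBits

/-! ### Lever windows: the abstract hypothesis behind XCIV -/

/-- `LeverWindow F N lo hi g`: `lo, hi ∈ F`, window values on `lo + gℤ`, and the one-step mean of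
StochasticA with `N` bits is monotone and `1`-Lipschitz on grid-congruent window points. -/
structure LeverWindow (F : Finset K) (N : ℕ) (lo hi g : K) : Prop where
  lo_mem : lo ∈ F
  hi_mem : hi ∈ F
  pos : 0 < g
  grid : ∀ a ∈ F, lo ≤ a → a ≤ hi → a - lo = ⌊(a - lo) / g⌋ * g
  lever : ∀ (c c' : K) (k : ℤ), lo ≤ c → c ≤ c' → c' ≤ hi → c' - c = k * g →
    stepQ F (probAwayA N) c (fun y => y) ≤ stepQ F (probAwayA N) c' (fun y => y) ∧
      stepQ F (probAwayA N) c' (fun y => y) - stepQ F (probAwayA N) c (fun y => y) ≤ c' - c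

/-- A one-signed nested window with `N ≥ J` bits is a lever window (XCIV `stepQA_lever`). -/
theorem NestedWindow.leverWindow {F : Finset K} {lo hi g : K} {J : ℕ} (hW : NestedWindow F lo hi g J)
    (hlo : 0 ≤ lo) {N : ℕ} (hJN : J ≤ N) : LeverWindow F N lo hi g :=
  ⟨hW.lo_mem, hW.hi_mem, hW.pos, hW.grid,
    fun _ _ _ h1 hcc h2 hk => hW.stepQA_lever hlo hJN h1 hcc h2 hk⟩

namespace LeverWindow

variable {F : Finset K} {N : ℕ} {lo hi g : K}

omit [IsStrictOrderedRing K] in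
/-- Window points lie in the hull of `F`. -/
theorem inHull (hW : LeverWindow F N lo hi g) {c : K} (h1 : lo ≤ c) (h2 : c ≤ hi) : InHull F c :=
  ⟨⟨lo, hW.lo_mem, h1⟩, ⟨hi, hW.hi_mem, h2⟩⟩

omit [IsStrictOrderedRing K] in
/-- The candidates of a window point. -/
theorem cand (hW : LeverWindow F N lo hi g) {c : K} (h1 : lo ≤ c) (h2 : c ≤ hi) :
    dn F c ∈ F ∧ up F c ∈ F ∧ lo ≤ dn F c ∧ up F c ≤ hi ∧ dn F c ≤ c ∧ c ≤ up F c := by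
  have hcl := clamp_eq_self (hW.inHull h1 h2)
  unfold dn up; rw [hcl]
  exact ⟨roundDown_mem ⟨lo, hW.lo_mem, h1⟩, roundUp_mem ⟨hi, hW.hi_mem, h2⟩,
    le_roundDown_of_mem hW.lo_mem h1, roundUp_le_of_mem hW.hi_mem h2, roundDown_le F c,
    le_roundUp F c⟩

omit [IsStrictOrderedRing K] in
/-- Two window points whose cells overlap share their cell. -/
theorem cell_eq (hW : LeverWindow F N lo hi g) {c c' : K} (h1 : lo ≤ c) (hcc : c ≤ c')
    (h2 : c' ≤ hi) (hlt : dn F c' < up F c) : dn F c' = dn F c ∧ up F c' = up F c := by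
  obtain ⟨hdF, huF, -, -, hdc, -⟩ := hW.cand h1 (hcc.trans h2)
  obtain ⟨hdF', huF', -, -, -, hcu'⟩ := hW.cand (h1.trans hcc) h2
  exact ⟨le_antisymm (le_dn_of_lt_up hdF' hlt) (le_dn_of_mem hdF (hdc.trans hcc)),
    le_antisymm (up_le_of_dn_lt huF hlt) (up_le_of_mem huF' (hcc.trans hcu'))⟩

/-- **Contraction of the mean map** on a lever window: `E[ŝₙ | ŝₖ = t'] − E[ŝₙ | ŝₖ = t] ≤ t' − t` for
window grid points `t ≤ t'` (trees unsaturated and inside the window).  XCIV's induction, verbatim. -/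
theorem accExpQA_contract (hW : LeverWindow F N lo hi g) :
    ∀ (x : ℕ → K) (n : ℕ) (t t' : K), t ∈ F → t' ∈ F → lo ≤ t → t' ≤ hi → t ≤ t' →
      NoSat F x n t → InWindow F lo hi x n t → NoSat F x n t' → InWindow F lo hi x n t' →
      accExpQ F (probAwayA N) x n (fun y => y) t'
        - accExpQ F (probAwayA N) x n (fun y => y) t ≤ t' - t := by
  intro x n
  induction n generalizing x with
  | zero => intro t t' _ _ _ _ _ _ _ _ _; simp [accExpQ]
  | succ n ih =>
    rintro t t' ht ht' hlt hth htt ⟨hin, hnu, hnd⟩ ⟨⟨h1, h2⟩, hwu, hwd⟩ ⟨hin', hnu', hnd'⟩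
      ⟨⟨h1', h2'⟩, hwu', hwd'⟩
    rw [clamp_eq_self hin] at h1 h2
    rw [clamp_eq_self hin'] at h1' h2'
    have hcc : t + x 0 ≤ t' + x 0 := by linarith
    have hm := hW.grid t ht hlt (htt.trans hth)
    have hm' := hW.grid t' ht' (hlt.trans htt) hth
    have hk : (t' + x 0) - (t + x 0) = ((⌊(t' - lo) / g⌋ - ⌊(t - lo) / g⌋ : ℤ) : K) * g := by
      push_cast; linear_combination hm' - hm
    obtain ⟨hτ1, hτ2⟩ := hW.lever _ _ _ h1 hcc h2' hk
    simp only [stepQ] at hτ1 hτ2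
    obtain ⟨hdF, huF, hlod, huhi, hdc, hcu⟩ := hW.cand h1 h2
    obtain ⟨hdF', huF', hlod', huhi', hdc', hcu'⟩ := hW.cand h1' h2'
    obtain ⟨hp0, hp1⟩ := pUpQ_mem F (probAwayA_mem N) (t + x 0)
    obtain ⟨hp0', hp1'⟩ := pUpQ_mem F (probAwayA_mem N) (t' + x 0)
    set q := probAwayA (K := K) N
    set x' : ℕ → K := fun i => x (i + 1)
    have IH1 := ih x' (dn F (t + x 0)) (up F (t + x 0)) hdF huF hlod huhi (hdc.trans hcu) hnd hwd hnu hwu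
    have IH2 := ih x' (dn F (t' + x 0)) (up F (t' + x 0)) hdF' huF' hlod' huhi' (hdc'.trans hcu')
      hnd' hwd' hnu' hwu'
    show stepQ F q (t' + x 0) (accExpQ F q x' n fun y => y)
        - stepQ F q (t + x 0) (accExpQ F q x' n fun y => y) ≤ t' - t
    simp only [stepQ]
    by_cases hsep : up F (t + x 0) ≤ dn F (t' + x 0)
    · have IH3 := ih x' (up F (t + x 0)) (dn F (t' + x 0)) huF hdF' (h1.trans hcu) (hdc'.trans h2')
        hsep hnu hwu hnd' hwd'
      set p := pUpQ F q (t + x 0)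
      set p' := pUpQ F q (t' + x 0)
      have e1 := mul_le_mul_of_nonneg_left IH2 hp0'
      have e2 := mul_le_mul_of_nonneg_left IH1 (sub_nonneg.mpr hp1)
      linarith [e1, e2, IH3, hτ2]
    · obtain ⟨hdd, huu⟩ := hW.cell_eq h1 hcc h2' (not_le.mp hsep)
      rw [hdd, huu] at hτ1 hτ2 ⊢
      set p := pUpQ F q (t + x 0)
      set p' := pUpQ F q (t' + x 0)
      rcases eq_or_lt_of_le (hdc.trans hcu) with hdu | hdu
      · rw [hdu]; linarith [htt]
      · have hpp : 0 ≤ p' - p :=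
          (mul_nonneg_iff_of_pos_right (sub_pos.mpr hdu)).mp (by linarith [hτ1])
        have e1 := mul_le_mul_of_nonneg_left IH1 hpp
        linarith [e1, hτ2]

/-- **StochasticA trees are drift-antitone on lever windows** (no saturation). -/
theorem driftAntitone_stochasticA (hW : LeverWindow F N lo hi g) :
    ∀ (x : ℕ → K) (n : ℕ) (s : K), NoSat F x n s → InWindow F lo hi x n s →
      DriftAntitone F (probAwayA N) x n s := by
  intro x n
  induction n generalizing x with
  | zero => intro s _ _; trivial
  | succ n ih =>
    rintro s ⟨hin, hnu, hnd⟩ ⟨⟨h1, h2⟩, hwu, hwd⟩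
    refine ⟨?_, ih _ _ hnu hwu, ih _ _ hnd hwd⟩
    rw [clamp_eq_self hin] at h1 h2
    obtain ⟨hdF, huF, hlod, huhi, hdc, hcu⟩ := hW.cand h1 h2
    have := hW.accExpQA_contract (fun i => x (i + 1)) n (dn F (s + x 0)) (up F (s + x 0)) hdF
      huF hlod huhi (hdc.trans hcu) hnd hwd hnu hwu
    linarith

/-- **The Pythagorean law on lever windows**: with every candidate gap `≤ G`,
`E(ŝₙ − sₙ)² ≤ n·G²/4 + (n·2^{-N}·G)²` for every `n`. -/
theorem stochasticA_acc_sq_le (hW : LeverWindow F N lo hi g) {G : K} (x : ℕ → K) (n : ℕ) (s : K)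
    (hns : NoSat F x n s) (hw : InWindow F lo hi x n s) (hgap : GapLE F G x n s) :
    accExpQ F (probAwayA N) x n (fun t => (t - (s + ∑ i ∈ range n, x i)) ^ 2) s
      ≤ n * (G ^ 2 / 4) + (n * (1 / 2 ^ N * G)) ^ 2 :=
  accExpQ_sq_le_of_driftAntitone F (probAwayA_mem N) (fun η _ _ => abs_probAwayA_sub_le N η) x n s hns
    hgap (hW.driftAntitone_stochasticA x n s hns hw)

end LeverWindow

/-! ### Windows across zero -/

section TwoSided

variable {F : Finset K}

omit [FloorRing K] in
/-- The step mean lies between the candidates. -/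
theorem dn_le_stepQ_id_le_up (F : Finset K) {q : K → K}
    (hq01 : ∀ η, 0 ≤ η → η ≤ 1 → 0 ≤ q η ∧ q η ≤ 1) (c : K) :
    dn F c ≤ stepQ F q c (fun y => y) ∧ stepQ F q c (fun y => y) ≤ up F c := by
  obtain ⟨hp0, hp1⟩ := pUpQ_mem F hq01 c
  have hdu := dn_le_up F c
  unfold stepQ
  constructor <;> nlinarith

/-- **A window across zero whose halves are nested is a lever window.**  If `[0, hi]` and `[0, hi']` are
nested windows of a symmetric value set containing `0` (spans `J, J' ≤ N`, common fine spacing `g`), then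
StochasticA with `N` bits has a monotone `1`-Lipschitz step mean on all of `[−hi', hi]`: on the positive
half by XCIV, on the negative half by reflection, and across zero for free (truncation moves both points
towards `0`). -/
theorem leverWindow_twoSided (hF : ∀ a ∈ F, -a ∈ F) (h0F : (0 : K) ∈ F) {hi hi' g : K} {J J' N : ℕ}
    (hP : NestedWindow F 0 hi g J) (hM : NestedWindow F 0 hi' g J') (hhi' : 0 ≤ hi') (hJ : J ≤ N)
    (hJ' : J' ≤ N) : LeverWindow F N (-hi') hi g where
  lo_mem := hF _ hM.hi_mem
  hi_mem := hP.hi_mem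
  pos := hP.pos
  grid := by
    intro a ha h1 h2
    have hg := hP.pos
    have e2 := hM.grid hi' hM.hi_mem hhi' le_rfl
    obtain ⟨m, hm⟩ : ∃ m : ℤ, a - -hi' = m * g := by
      rcases le_or_gt 0 a with ha0 | ha0
      · have e1 := hP.grid a ha ha0 h2
        exact ⟨⌊(a - 0) / g⌋ + ⌊(hi' - 0) / g⌋, by push_cast; linear_combination e1 + e2⟩
      · have e1 := hM.grid (-a) (hF a ha) (by linarith) (by linarith)
        exact ⟨-⌊(-a - 0) / g⌋ + ⌊(hi' - 0) / g⌋, by push_cast; linear_combination -e1 + e2⟩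
    rw [hm, mul_div_cancel_right₀ _ hg.ne', Int.floor_intCast]
  lever := by
    intro c c' k h1 hcc h2 hk
    have hq01 := probAwayA_mem (K := K) N
    rcases le_or_gt 0 c with hc0 | hc0
    · -- both points on the positive half
      exact hP.stepQA_lever le_rfl hJ hc0 hcc h2 hk
    rcases le_or_gt c' 0 with hc'0 | hc'0
    · -- both points on the negative half: mirror image of XCIV's lever on `[0, hi']`
      have hc : InHull F c := ⟨⟨-hi', hF _ hM.hi_mem, h1⟩, ⟨0, h0F, hc0.le⟩⟩
      have hc' : InHull F c' := ⟨⟨-hi', hF _ hM.hi_mem, h1.trans hcc⟩, ⟨0, h0F, hc'0⟩⟩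
      have h := hM.stepQA_lever le_rfl hJ' (c := -c') (c' := -c) (k := k) (by linarith)
        (by linarith) (by linarith) (by linear_combination hk)
      rw [stepQ_id_neg hF h0F _ hc, stepQ_id_neg hF h0F _ hc'] at h
      constructor <;> linarith [h.1, h.2]
    · -- across zero: `c ≤ τ(c) ≤ ⌈c̄⌉ ≤ 0 ≤ ⌊c̄'⌋ ≤ τ(c') ≤ c'`
      have hc : InHull F c := ⟨⟨-hi', hF _ hM.hi_mem, h1⟩, ⟨0, h0F, hc0.le⟩⟩
      have hc' : InHull F c' := ⟨⟨-hi', hF _ hM.hi_mem, h1.trans hcc⟩, ⟨hi, hP.hi_mem, h2⟩⟩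
      have hu : up F c ≤ 0 := up_le_of_mem h0F hc0.le
      have hd' : 0 ≤ dn F c' := le_dn_of_mem h0F hc'0.le
      have hdc : dn F c < 0 := by
        have : dn F c ≤ c := by unfold dn; rw [clamp_eq_self hc]; exact roundDown_le F c
        linarith
      obtain ⟨-, hτu⟩ := dn_le_stepQ_id_le_up F hq01 c
      obtain ⟨hτd', -⟩ := dn_le_stepQ_id_le_up F hq01 c'
      have htz := (stepQ_towards_zero F (fun η _ _ => probAwayA_le N η) c).2 hdc
      have htz' := (stepQ_towards_zero F (fun η _ _ => probAwayA_le N η) c').1 hd'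
      rw [clamp_eq_self hc] at htz
      rw [clamp_eq_self hc'] at htz'
      constructor <;> linarith

/-- Candidate gaps on a window across zero with nested halves are `≤ G` once `2^J·g, 2^J'·g ≤ G`. -/
theorem gapLE_twoSided (hF : ∀ a ∈ F, -a ∈ F) {hi hi' g : K} {J J' : ℕ} (hP : NestedWindow F 0 hi g J)
    (hM : NestedWindow F 0 hi' g J') {G : K} (hGJ : 2 ^ J * g ≤ G) (hGJ' : 2 ^ J' * g ≤ G) :
    ∀ (x : ℕ → K) (n : ℕ) (s : K), NoSat F x n s → InWindow F (-hi') hi x n s → GapLE F G x n s := by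
  intro x n
  induction n generalizing x with
  | zero => intro s _ _; trivial
  | succ n ih =>
    rintro s ⟨hin, hnu, hnd⟩ ⟨⟨h1, h2⟩, hwu, hwd⟩
    refine ⟨?_, ih _ _ hnu hwu, ih _ _ hnd hwd⟩
    have hg := hP.pos
    have hG : 0 ≤ G := le_trans (by positivity) hGJ
    set c := s + x 0
    rw [clamp_eq_self hin] at h1 h2
    show up F c - dn F c ≤ G
    rcases le_or_gt 0 c with hc0 | hc0
    · by_cases hne : up F c = dn F c
      · rw [hne, sub_self]; exact hG
      · obtain ⟨j, hj, hw⟩ := hP.width c hc0 h2 hne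
        rw [hw]
        exact le_trans (mul_le_mul_of_nonneg_right (pow_le_pow_right₀ (by norm_num) hj) hg.le) hGJ
    · have e1 : up F c = -dn F (-c) := by rw [dn_neg hF hin, neg_neg]
      have e2 : dn F c = -up F (-c) := by rw [up_neg hF hin, neg_neg]
      rw [e1, e2, show -dn F (-c) - -up F (-c) = up F (-c) - dn F (-c) by ring]
      by_cases hne : up F (-c) = dn F (-c)
      · rw [hne, sub_self]; exact hG
      · obtain ⟨j, hj, hw⟩ := hM.width (-c) (by linarith) (by linarith) hne
        rw [hw]
        exact le_trans (mul_le_mul_of_nonneg_right (pow_le_pow_right₀ (by norm_num) hj) hg.le) hGJ'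

/-- **The Pythagorean law ACROSS ZERO.**  On a window `[−hi', hi]` of a symmetric value set containing
`0` whose halves are nested with spans `J, J' ≤ N`, StochasticA with `N` bits is drift-antitone and
`E(ŝₙ − sₙ)² ≤ n·G²/4 + (n·2^{-N}·G)²` for every `n`, for any `G ≥ 2^J·g, 2^J'·g` (no saturation). -/
theorem stochasticA_twoSided (hF : ∀ a ∈ F, -a ∈ F) (h0F : (0 : K) ∈ F) {hi hi' g : K}
    {J J' N : ℕ} (hP : NestedWindow F 0 hi g J) (hM : NestedWindow F 0 hi' g J')
    (hhi' : 0 ≤ hi') (hJ : J ≤ N) (hJ' : J' ≤ N) {G : K} (hGJ : 2 ^ J * g ≤ G) (hGJ' : 2 ^ J' * g ≤ G)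
    (x : ℕ → K) (n : ℕ) (s : K) (hns : NoSat F x n s) (hw : InWindow F (-hi') hi x n s) :
    DriftAntitone F (probAwayA N) x n s ∧
      accExpQ F (probAwayA N) x n (fun t => (t - (s + ∑ i ∈ range n, x i)) ^ 2) s
        ≤ n * (G ^ 2 / 4) + (n * (1 / 2 ^ N * G)) ^ 2 :=
  have hW := leverWindow_twoSided hF h0F hP hM hhi' hJ hJ'
  ⟨hW.driftAntitone_stochasticA x n s hns hw,
    hW.stochasticA_acc_sq_le x n s hns hw (gapLE_twoSided hF hP hM hGJ hGJ' x n s hns hw)⟩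

end TwoSided

end LimitedBits

end Summit.Ventures.CertifiedArithmetic.LowPrec.SR
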